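import Mathlib
import HarnessLib

/-!
# `CurvatureKernelBound` — stub P `PartitionBump` (support for stmt-QuantumFields-11687, line `sixteen-charts-analytic-kernel`, skeleton v11)

An exact smooth partition of unity on ℝ⁴ by the integer translates of one bump.
-/

noncomputable section

open scoped BigOperators Topology SchwartzMap ComplexConjugate InnerProductSpace
open MeasureTheory Filter Set Metric

namespace Summit.QuantumFields.YangMills.Theorems.CurvatureKernel

/-- The 1D bump `ψ t = smoothTransition (t + 1) - smoothTransition t` is nonnegative. -/
theorem partitionBump_psi_nonneg (t : ℝ) :
    0 ≤ Real.smoothTransition (t + 1) - Real.smoothTransition t :=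
  sub_nonneg.2 (Real.smoothTransition.monotone (by linarith))

/-- The 1D bump `ψ` is at most `1`. -/
theorem partitionBump_psi_le_one (t : ℝ) :
    Real.smoothTransition (t + 1) - Real.smoothTransition t ≤ 1 := by
  linarith [Real.smoothTransition.le_one (t + 1), Real.smoothTransition.nonneg t]

/-- The 1D bump `ψ` vanishes outside `(-1, 1)`. -/
theorem partitionBump_psi_eq_zero {t : ℝ} (ht : 1 ≤ |t|) :
    Real.smoothTransition (t + 1) - Real.smoothTransition t = 0 := by
  rcases le_or_gt 0 t with h | h
  · rw [abs_of_nonneg h] at ht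
    rw [Real.smoothTransition.one_of_one_le (by linarith),
      Real.smoothTransition.one_of_one_le ht, sub_self]
  · rw [abs_of_neg h] at ht
    rw [Real.smoothTransition.zero_of_nonpos (by linarith),
      Real.smoothTransition.zero_of_nonpos (by linarith), sub_self]

/-- Telescoping of the translates of `ψ` over `Finset.range`. -/
theorem partitionBump_psi_sum_range (t : ℝ) (n : ℕ) :
    ∑ k ∈ Finset.range n,
        (Real.smoothTransition (t - k + 1) - Real.smoothTransition (t - k)) =
      Real.smoothTransition (t + 1) - Real.smoothTransition (t + 1 - n) := by
  have h := Finset.sum_range_sub' (fun k : ℕ => Real.smoothTransition (t + 1 - k)) n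
  simp only [Nat.cast_zero, sub_zero] at h
  rw [← h]
  refine Finset.sum_congr rfl fun k _ => ?_
  rw [show t + 1 - (k : ℝ) = t - k + 1 by ring,
    show t + 1 - ((k + 1 : ℕ) : ℝ) = t - k by push_cast; ring]

/-- Telescoping of the translates of `ψ` over the integer interval `[-N, N]`:
`∑_{m=-N}^{N} ψ (t - m) = smoothTransition (t + N + 1) - smoothTransition (t - N)`. -/
theorem partitionBump_psi_sum_Icc (t : ℝ) (N : ℕ) :
    ∑ m ∈ Finset.Icc (-(N : ℤ)) N,
        (Real.smoothTransition (t - m + 1) - Real.smoothTransition (t - m)) =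
      Real.smoothTransition (t + N + 1) - Real.smoothTransition (t - N) := by
  rw [Int.Icc_eq_finset_map, Finset.sum_map]
  have h : ((N : ℤ) + 1 - -(N : ℤ)).toNat = 2 * N + 1 := by omega
  have h2 := partitionBump_psi_sum_range (t + N) (2 * N + 1)
  rw [show t + N + 1 - ((2 * N + 1 : ℕ) : ℝ) = t - N by push_cast; ring] at h2
  rw [h, ← h2]
  refine Finset.sum_congr rfl fun k _ => ?_
  simp only [Function.Embedding.trans_apply, Nat.castEmbedding_apply, addLeftEmbedding_apply,
    Int.cast_add, Int.cast_neg, Int.cast_natCast]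
  rw [show t - (-(N : ℝ) + k) = t + N - k by ring]

/-- The 1D partial sums `∑_{m=-N}^{N} ψ (t - m)` lie in `[0, 1]`. -/
theorem partitionBump_psi_sum_Icc_mem (t : ℝ) (N : ℕ) :
    0 ≤ Real.smoothTransition (t + N + 1) - Real.smoothTransition (t - N) ∧
      Real.smoothTransition (t + N + 1) - Real.smoothTransition (t - N) ≤ 1 := by
  refine ⟨sub_nonneg.2 (Real.smoothTransition.monotone (by linarith)), ?_⟩
  linarith [Real.smoothTransition.le_one (t + N + 1), Real.smoothTransition.nonneg (t - N)]

/-- The 1D partial sums `∑_{m=-N}^{N} ψ (t - m)` equal `1` when `|t| ≤ N`. -/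
theorem partitionBump_psi_sum_Icc_eq_one {t : ℝ} {N : ℕ} (ht : |t| ≤ N) :
    Real.smoothTransition (t + N + 1) - Real.smoothTransition (t - N) = 1 := by
  rw [abs_le] at ht
  rw [Real.smoothTransition.one_of_one_le (by linarith),
    Real.smoothTransition.zero_of_nonpos (by linarith), sub_zero]

/-- The 4D partial sums of the translates of `ϖ x = ∏ i, ψ (x i)` over the cube `[-N, N]⁴`
factor as a product of the 1D telescoped sums. -/
theorem partitionBump_sum_piFinset (N : ℕ) (y : EuclideanSpace ℝ (Fin 4)) :
    ∑ j ∈ Fintype.piFinset (fun _ : Fin 4 => Finset.Icc (-(N : ℤ)) N),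
        (fun x : EuclideanSpace ℝ (Fin 4) =>
          ∏ i : Fin 4, (Real.smoothTransition (x i + 1) - Real.smoothTransition (x i)))
          (y - WithLp.toLp 2 (fun i => ((j i : ℤ) : ℝ))) =
      ∏ i : Fin 4, (Real.smoothTransition (y i + N + 1) - Real.smoothTransition (y i - N)) := by
  calc _ = ∑ j ∈ Fintype.piFinset (fun _ : Fin 4 => Finset.Icc (-(N : ℤ)) N),
          ∏ i : Fin 4, (Real.smoothTransition (y i - (j i : ℝ) + 1) -
            Real.smoothTransition (y i - (j i : ℝ))) := by
        refine Finset.sum_congr rfl fun j _ => ?_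
        simp only [PiLp.sub_apply]
    _ = ∏ i : Fin 4, ∑ m ∈ Finset.Icc (-(N : ℤ)) N,
          (Real.smoothTransition (y i - m + 1) - Real.smoothTransition (y i - m)) :=
        Finset.sum_prod_piFinset _
          (fun i (m : ℤ) => Real.smoothTransition (y i - m + 1) - Real.smoothTransition (y i - m))
    _ = _ := Finset.prod_congr rfl fun i _ => partitionBump_psi_sum_Icc (y i) N

/-- **Stub `PartitionBump`** (registered signature verbatim). `ϖ(x) = Π_μ ψ(x_μ)` with `ψ(t) = Real.smoothTransition (t + 1) - Real.smoothTransition t`: smooth, `0 ≤ ψ ≤ 1`, `supp ψ ⊆ [-1,1]`, `Σ_{j=-N}^{N} ψ(t-j) = smoothTransition (t+N+1) - smoothTransition (t-N)` telescopes (≤ 1 always, = 1 for |t| ≤ N); the 4D sums factor over coordinates (`Finset.prod_univ_sum`). [folklore] -/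
theorem PartitionBump : (∃ ϖ : (EuclideanSpace ℝ (Fin 4)) → ℝ, ContDiff ℝ (⊤ : ℕ∞) ϖ ∧ (∀ x, 0 ≤ ϖ x) ∧ (∀ x, ϖ x ≤ 1) ∧ tsupport ϖ ⊆ Metric.closedBall (0 : (EuclideanSpace ℝ (Fin 4))) 2 ∧ 0 < ∫ x, ϖ x ∧ (∀ (N : ℕ) (y : (EuclideanSpace ℝ (Fin 4))), ∑ j ∈ Fintype.piFinset (fun _ : Fin 4 => Finset.Icc (-(N : ℤ)) N), ϖ (y - WithLp.toLp 2 (fun i => ((j i : ℤ) : ℝ))) ≤ 1) ∧ (∀ (N : ℕ) (y : (EuclideanSpace ℝ (Fin 4))), (∀ i : Fin 4, |y i| ≤ N) → ∑ j ∈ Fintype.piFinset (fun _ : Fin 4 => Finset.Icc (-(N : ℤ)) N), ϖ (y - WithLp.toLp 2 (fun i => ((j i : ℤ) : ℝ))) = 1)) := by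
  -- smoothness
  have hsmooth : ContDiff ℝ (⊤ : ℕ∞) (fun x : EuclideanSpace ℝ (Fin 4) =>
      ∏ i : Fin 4, (Real.smoothTransition (x i + 1) - Real.smoothTransition (x i))) := by
    refine contDiff_prod fun i _ => ?_
    exact (Real.smoothTransition.contDiff.comp
      ((contDiff_piLp_apply (p := 2) (i := i)).add contDiff_const)).sub
      (Real.smoothTransition.contDiff.comp (contDiff_piLp_apply (p := 2) (i := i)))
  -- nonnegativity
  have hnonneg : ∀ x : EuclideanSpace ℝ (Fin 4), 0 ≤ (fun x : EuclideanSpace ℝ (Fin 4) =>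
      ∏ i : Fin 4, (Real.smoothTransition (x i + 1) - Real.smoothTransition (x i))) x :=
    fun x => Finset.prod_nonneg fun i _ => partitionBump_psi_nonneg (x i)
  -- bounded by one
  have hle : ∀ x : EuclideanSpace ℝ (Fin 4), (fun x : EuclideanSpace ℝ (Fin 4) =>
      ∏ i : Fin 4, (Real.smoothTransition (x i + 1) - Real.smoothTransition (x i))) x ≤ 1 :=
    fun x => Finset.prod_le_one (fun i _ => partitionBump_psi_nonneg (x i))
      fun i _ => partitionBump_psi_le_one (x i)
  -- support
  have hsupp : tsupport (fun x : EuclideanSpace ℝ (Fin 4) =>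
      ∏ i : Fin 4, (Real.smoothTransition (x i + 1) - Real.smoothTransition (x i))) ⊆
      Metric.closedBall (0 : EuclideanSpace ℝ (Fin 4)) 2 := by
    refine closure_minimal (fun x hx => ?_) Metric.isClosed_closedBall
    rw [Function.mem_support] at hx
    have hxi : ∀ i : Fin 4, |x i| ≤ 1 := fun i => by
      by_contra h
      exact hx (Finset.prod_eq_zero (Finset.mem_univ i)
        (partitionBump_psi_eq_zero (not_le.1 h).le))
    rw [Metric.mem_closedBall, dist_zero_right, EuclideanSpace.norm_eq,
      Real.sqrt_le_left (by norm_num : (0 : ℝ) ≤ 2)]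
    calc ∑ i : Fin 4, ‖x i‖ ^ 2 ≤ ∑ _i : Fin 4, (1 : ℝ) :=
          Finset.sum_le_sum fun i _ => by
            rw [Real.norm_eq_abs, sq_le_one_iff_abs_le_one, abs_abs]
            exact hxi i
      _ ≤ 2 ^ 2 := by norm_num
  -- compact support
  have hcpt : HasCompactSupport (fun x : EuclideanSpace ℝ (Fin 4) =>
      ∏ i : Fin 4, (Real.smoothTransition (x i + 1) - Real.smoothTransition (x i))) :=
    (isCompact_closedBall (0 : EuclideanSpace ℝ (Fin 4)) 2).of_isClosed_subset
      (isClosed_tsupport _) hsupp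
  -- positivity of the integral
  have hint : 0 < ∫ x, (fun x : EuclideanSpace ℝ (Fin 4) =>
      ∏ i : Fin 4, (Real.smoothTransition (x i + 1) - Real.smoothTransition (x i))) x := by
    refine hsmooth.continuous.integral_pos_of_hasCompactSupport_nonneg_nonzero hcpt hnonneg
      (x := 0) ?_
    simp
  -- the partial sums
  have hsum_le : ∀ (N : ℕ) (y : EuclideanSpace ℝ (Fin 4)),
      ∑ j ∈ Fintype.piFinset (fun _ : Fin 4 => Finset.Icc (-(N : ℤ)) N),
        (fun x : EuclideanSpace ℝ (Fin 4) =>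
          ∏ i : Fin 4, (Real.smoothTransition (x i + 1) - Real.smoothTransition (x i)))
          (y - WithLp.toLp 2 (fun i => ((j i : ℤ) : ℝ))) ≤ 1 := fun N y => by
    rw [partitionBump_sum_piFinset]
    exact Finset.prod_le_one (fun i _ => (partitionBump_psi_sum_Icc_mem (y i) N).1)
      fun i _ => (partitionBump_psi_sum_Icc_mem (y i) N).2
  have hsum_eq : ∀ (N : ℕ) (y : EuclideanSpace ℝ (Fin 4)), (∀ i : Fin 4, |y i| ≤ N) →
      ∑ j ∈ Fintype.piFinset (fun _ : Fin 4 => Finset.Icc (-(N : ℤ)) N),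
        (fun x : EuclideanSpace ℝ (Fin 4) =>
          ∏ i : Fin 4, (Real.smoothTransition (x i + 1) - Real.smoothTransition (x i)))
          (y - WithLp.toLp 2 (fun i => ((j i : ℤ) : ℝ))) = 1 := fun N y hy => by
    rw [partitionBump_sum_piFinset]
    exact Finset.prod_eq_one fun i _ => partitionBump_psi_sum_Icc_eq_one (hy i)
  exact ⟨_, hsmooth, hnonneg, hle, hsupp, hint, hsum_le, hsum_eq⟩

end Summit.QuantumFields.YangMills.Theorems.CurvatureKernel

end
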